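import Literature.Combinatorics.Sahi2008.Functional
import Mathlib.Tactic.Linarith
import Mathlib.Tactic.Ring
import Mathlib.Tactic.Positivity
import HarnessLib

/-!
# `NoHeavyLowerTail` (crux stmt-CriticalPhenomena-4575), P2 — the DOMINANCE LEMMA behind the all-`K` staircase theorem

Memo SAHI-ROUTE.md §4.26 (seat `prim-masterthm-p2`, gen 8; `--supports stmt-CriticalPhenomena-4575`).  No `sorry`, no named facts,
standard axioms.  Pure real-number inequalities (no measure theory); consumed by `…SahiTriangleStaircaseAll`.

THE ABSTRACT SITUATION.  Levels `0, 1, …, n−1` (read: `0` = top).  A nonnegative "mass profile" `u` on the levels is TOP-HEAVY with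
respect to the profile `G·p` (`p ≥ 0`) if every initial segment carries at least its share: `Σ_{l ≤ i} u_l ≥ G·Σ_{l ≤ i} p_l` for all
`i < n`.  (In the application: `u_l = E_c[(φ_{l+1} − φ_l) g(·,b)]` are the masses the monotone function `g(·,b)` puts on the levels of a
staircase member, `p_l = E φ_{l+1} − E φ_l` are the a-priori weights of the levels, `G = E_c g(·,b)`, and top-heaviness is
Chebyshev's/FKG's inequality `E_c[φ_{i+1} g] ≥ E φ_{i+1} · E_c g` on the block `γ`.)

* `abel_nonneg` — Abel summation: if all partial sums of `d` are `≥ 0` and `θ ≥ 0` is antitone then `Σ d_l θ_l ≥ 0`.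
* `dominance` — **if `u` is top-heavy w.r.t. `G·p` and `Ψ_{i'} ≤ Φ_i` whenever `i ≤ i'`, then `G·Σ p_l Ψ_l ≤ Σ u_l Φ_l`**
  (`u, p, Φ ≥ 0`, `G ≥ 0`).  Proof: `Σ u Φ ≥ Σ u Φ* ≥ G Σ p Φ* ≥ G Σ p Ψ` with `Φ*_l = min_{i≤l} Φ_i` (a `Finset.inf'`).
* `margin` — the MARGIN INEQUALITY of the staircase theorem: for `V ≥ 0` antitone with `V_l ≥ Q_l H`, `0 ≤ ρ ≤ 1` and the
  condition `(⋆) Q_{i'} ≤ (1 − ρ_i + ρ_{i'}) Q_i` (`i ≤ i'`): `Q_{i'} H + (1 − ρ_{i'}) V_{i'} ≤ (2 − ρ_i) V_i` for `i ≤ i'`.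
* `star_of_ratio` — `(⋆)` holds for the RATIO CHOICE `ρ_l V̄_l = Q_l H̄` (`ρ_l = 1` where `V̄_l = 0`), `V̄` antitone, `V̄_l ≥ Q_l H̄`,
  `Q ≥ 0` antitone.
-/

namespace Summit.CriticalPhenomena.PercolationContinuityZ3.Theorems

namespace SahiTriangleStaircaseAll

open Finset

/-! ### Abel summation -/

/-- **Abel summation, sign form.**  If every partial sum `Σ_{l ≤ i} d_l` (`i < n`) is nonnegative and `θ` is nonnegative and
antitone on `{0,…,n−1}`, then `Σ_{l < n} d_l θ_l ≥ 0`. [folklore] -/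
theorem abel_nonneg : ∀ (n : ℕ) (d θ : ℕ → ℝ), (∀ i, i < n → 0 ≤ ∑ l ∈ range (i + 1), d l) →
    (∀ i j, i ≤ j → j < n → θ j ≤ θ i) → (∀ i, i < n → 0 ≤ θ i) → 0 ≤ ∑ l ∈ range n, d l * θ l := by
  intro n
  induction n with
  | zero => intro d θ _ _ _; simp
  | succ n ih =>
    intro d θ hD hθ hθ0
    -- Σ_{l<n+1} d_l θ_l = θ_n Σ_{l<n+1} d_l + Σ_{l<n} d_l (θ_l − θ_n)
    have inner : (∑ l ∈ range n, d l * θ l) = θ n * (∑ l ∈ range n, d l) + ∑ l ∈ range n, d l * (θ l - θ n) := by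
      rw [mul_sum, ← sum_add_distrib]
      exact sum_congr rfl fun l _ => by ring
    have split : (∑ l ∈ range (n + 1), d l * θ l) =
        θ n * (∑ l ∈ range (n + 1), d l) + ∑ l ∈ range n, d l * (θ l - θ n) := by
      rw [sum_range_succ, sum_range_succ, inner]
      ring
    rw [split]
    have h1 : 0 ≤ θ n * ∑ l ∈ range (n + 1), d l :=
      mul_nonneg (hθ0 n (Nat.lt_succ_self n)) (hD n (Nat.lt_succ_self n))
    have h2 : 0 ≤ ∑ l ∈ range n, d l * (θ l - θ n) := by
      refine ih d (fun l => θ l - θ n) (fun i hi => hD i (Nat.lt_succ_of_lt hi)) ?_ ?_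
      · intro i j hij hj
        have := hθ i j hij (Nat.lt_succ_of_lt hj)
        linarith
      · intro i hi
        have := hθ i n (le_of_lt hi) (Nat.lt_succ_self n)
        linarith
    linarith

/-! ### The dominance lemma -/

/-- **DOMINANCE LEMMA.**  `u, p, Φ ≥ 0`, `G ≥ 0`; `u` top-heavy w.r.t. `G·p` (`G·Σ_{l≤i} p_l ≤ Σ_{l≤i} u_l` for `i < n`);
`Ψ_{i'} ≤ Φ_i` whenever `i ≤ i' < n`.  Then `G·Σ_{l<n} p_l Ψ_l ≤ Σ_{l<n} u_l Φ_l`.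
Proof: `Σ u Φ ≥ Σ u Φ* ≥ G Σ p Φ* ≥ G Σ p Ψ` with `Φ*_l = min_{i ≤ l} Φ_i` (antitone, `Ψ ≤ Φ* ≤ Φ`; the middle step is
`abel_nonneg`). [this work] -/
theorem dominance (n : ℕ) (u p Φ Ψ : ℕ → ℝ) (G : ℝ) (hu : ∀ l, 0 ≤ u l) (hp : ∀ l, 0 ≤ p l) (hG : 0 ≤ G)
    (hΦ0 : ∀ l, 0 ≤ Φ l) (hdom : ∀ i, i < n → G * ∑ l ∈ range (i + 1), p l ≤ ∑ l ∈ range (i + 1), u l)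
    (hmargin : ∀ i i', i ≤ i' → i' < n → Ψ i' ≤ Φ i) :
    G * ∑ l ∈ range n, p l * Ψ l ≤ ∑ l ∈ range n, u l * Φ l := by
  -- the running minimum Φ*_l = min_{i ≤ l} Φ_i
  let θ : ℕ → ℝ := fun l => (range (l + 1)).inf' ⟨0, mem_range.mpr (Nat.succ_pos l)⟩ Φ
  have hθle : ∀ l, θ l ≤ Φ l := fun l => inf'_le Φ (mem_range.mpr (Nat.lt_succ_self l))
  have hleθ : ∀ l (c : ℝ), (∀ i, i ≤ l → c ≤ Φ i) → c ≤ θ l := fun l c hc =>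
    le_inf' _ _ fun i hi => hc i (Nat.lt_succ_iff.mp (mem_range.mp hi))
  have hθanti : ∀ i j, i ≤ j → θ j ≤ θ i := fun i j hij =>
    hleθ i (θ j) fun k hk => inf'_le Φ (mem_range.mpr (Nat.lt_succ_of_le (hk.trans hij)))
  -- step 1: Σ u Φ ≥ Σ u Φ*
  have s1 : (∑ l ∈ range n, u l * θ l) ≤ ∑ l ∈ range n, u l * Φ l :=
    sum_le_sum fun l _ => mul_le_mul_of_nonneg_left (hθle l) (hu l)
  -- step 3: G Σ p Ψ ≤ G Σ p Φ*
  have s3 : G * ∑ l ∈ range n, p l * Ψ l ≤ G * ∑ l ∈ range n, p l * θ l := by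
    refine mul_le_mul_of_nonneg_left (sum_le_sum fun l hl => mul_le_mul_of_nonneg_left ?_ (hp l)) hG
    exact hleθ l (Ψ l) fun i hi => hmargin i l hi (mem_range.mp hl)
  -- step 2: Σ (u − G p) Φ* ≥ 0 by Abel
  have s2 : 0 ≤ ∑ l ∈ range n, (u l - G * p l) * θ l := by
    refine abel_nonneg n (fun l => u l - G * p l) θ ?_ (fun i j hij _ => hθanti i j hij) ?_
    · intro i hi
      have h := hdom i hi
      rw [sum_sub_distrib, ← mul_sum]
      linarith
    · intro i _
      exact hleθ i 0 fun j _ => hΦ0 j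
  have e2 : (∑ l ∈ range n, (u l - G * p l) * θ l) =
      (∑ l ∈ range n, u l * θ l) - G * ∑ l ∈ range n, p l * θ l := by
    rw [mul_sum, ← sum_sub_distrib]
    exact sum_congr rfl fun l _ => by ring
  rw [e2] at s2
  linarith

/-! ### The margin inequality and the ratio choice -/

/-- **MARGIN INEQUALITY.**  `H ≥ 0`; `V ≥ 0` antitone with `Q_l H ≤ V_l`; `0 ≤ ρ ≤ 1`; and `(⋆) Q_{i'} ≤ (1 − ρ_i + ρ_{i'}) Q_i` for
`i ≤ i'`.  Then for `i ≤ i'`: `Q_{i'} H + (1 − ρ_{i'}) V_{i'} ≤ (2 − ρ_i) V_i`.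
Proof: `(2−ρ_i)V_i − (1−ρ_{i'})V_{i'} ≥ (1 − ρ_i + ρ_{i'}) V_i ≥ (1 − ρ_i + ρ_{i'}) Q_i H ≥ Q_{i'} H`. [this work] -/
theorem margin (ρ Q V : ℕ → ℝ) (H : ℝ) (hH : 0 ≤ H) (hρ0 : ∀ l, 0 ≤ ρ l) (hρ1 : ∀ l, ρ l ≤ 1)
    (hVanti : ∀ i j, i ≤ j → V j ≤ V i) (hVQ : ∀ l, Q l * H ≤ V l)
    (hstar : ∀ i j, i ≤ j → Q j ≤ (1 - ρ i + ρ j) * Q i) (i j : ℕ) (hij : i ≤ j) :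
    Q j * H + (1 - ρ j) * V j ≤ (2 - ρ i) * V i := by
  have h1 : (1 - ρ j) * V j ≤ (1 - ρ j) * V i :=
    mul_le_mul_of_nonneg_left (hVanti i j hij) (by linarith [hρ1 j])
  have hc : 0 ≤ 1 - ρ i + ρ j := by linarith [hρ1 i, hρ0 j]
  have h2 : (1 - ρ i + ρ j) * (Q i * H) ≤ (1 - ρ i + ρ j) * V i := mul_le_mul_of_nonneg_left (hVQ i) hc
  have h3 : Q j * H ≤ (1 - ρ i + ρ j) * Q i * H := mul_le_mul_of_nonneg_right (hstar i j hij) hH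
  nlinarith [h1, h2, h3]

/-- **`(⋆)` for the ratio choice.**  `H̄ ≥ 0`; `Q ≥ 0` antitone; `V̄` antitone with `Q_l H̄ ≤ V̄_l`; `ρ` with `ρ_l V̄_l = Q_l H̄`,
`0 ≤ ρ`, and `ρ_l = 1` where `V̄_l = 0`.  Then `Q_{i'} ≤ (1 − ρ_i + ρ_{i'}) Q_i` for `i ≤ i'`.
Proof: `(1 − ρ_i + ρ_{i'}) Q_i V̄_i ≥ Q_i V̄_i − Q_i² H̄ + Q_i Q_{i'} H̄ = Q_{i'} V̄_i + (Q_i − Q_{i'})(V̄_i − Q_i H̄) ≥ Q_{i'} V̄_i`,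
then cancel `V̄_i > 0` (if `V̄_i = 0` then `V̄_{i'} = 0` and `ρ_i = ρ_{i'} = 1`). [this work] -/
theorem star_of_ratio (ρ Q Vb : ℕ → ℝ) (Hb : ℝ) (hHb : 0 ≤ Hb) (hQ0 : ∀ l, 0 ≤ Q l)
    (hQanti : ∀ i j, i ≤ j → Q j ≤ Q i) (hVanti : ∀ i j, i ≤ j → Vb j ≤ Vb i) (hVQ : ∀ l, Q l * Hb ≤ Vb l)
    (hρ : ∀ l, ρ l * Vb l = Q l * Hb) (hρ0 : ∀ l, 0 ≤ ρ l) (hρdeg : ∀ l, Vb l = 0 → ρ l = 1)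
    (i j : ℕ) (hij : i ≤ j) : Q j ≤ (1 - ρ i + ρ j) * Q i := by
  have hVj0 : 0 ≤ Vb j := le_trans (mul_nonneg (hQ0 j) hHb) (hVQ j)
  by_cases hVi : Vb i = 0
  · -- degenerate level: V̄_i = 0 ⇒ V̄_j = 0 ⇒ ρ_i = ρ_j = 1
    have hVj : Vb j = 0 := le_antisymm (by simpa [hVi] using hVanti i j hij) hVj0
    rw [hρdeg i hVi, hρdeg j hVj]
    have := hQanti i j hij
    linarith
  · have hVi0 : 0 < Vb i := lt_of_le_of_ne (le_trans hVj0 (hVanti i j hij)) (Ne.symm hVi)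
    -- (1 − ρ_i + ρ_j) Q_i V̄_i ≥ Q_j V̄_i
    have key : Q j * Vb i ≤ (1 - ρ i + ρ j) * Q i * Vb i := by
      have e1 : (1 - ρ i + ρ j) * Q i * Vb i = Q i * Vb i - Q i * (ρ i * Vb i) + ρ j * Q i * Vb i := by ring
      have e0 : (1 - ρ i + ρ j) * Q i * Vb i = Q i * Vb i - Q i * (Q i * Hb) + ρ j * Q i * Vb i := by
        rw [e1, hρ i]
      have h2 : ρ j * Q i * Vb j ≤ ρ j * Q i * Vb i :=
        mul_le_mul_of_nonneg_left (hVanti i j hij) (mul_nonneg (hρ0 j) (hQ0 i))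
      have e3 : ρ j * Q i * Vb j = Q i * (Q j * Hb) := by rw [← hρ j]; ring
      have h4 : 0 ≤ (Q i - Q j) * (Vb i - Q i * Hb) := mul_nonneg (by linarith [hQanti i j hij]) (by linarith [hVQ i])
      have e5 : Q j * Vb i + (Q i - Q j) * (Vb i - Q i * Hb) = Q i * Vb i - Q i * (Q i * Hb) + Q i * (Q j * Hb) := by
        ring
      linarith [e0, h2, e3, h4, e5]
    exact le_of_mul_le_mul_right key hVi0

end SahiTriangleStaircaseAll

end Summit.CriticalPhenomena.PercolationContinuityZ3.Theorems
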